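import Summits.QuantumFields.BalabanUV.Beta.EriceFlowEnclosureB12AsPrintedHistoryContagionShiftFlowZeroIsometry

/-!
# Beta / EriceFlowEnclosureB12AsPrintedHistoryContagionShiftFlowZeroPrincipal — ASYMPTOTIC FREEDOM IS CONTAGIOUS, part 45: THE Λ-COORDINATE IS THE PRINCIPAL ABEL FUNCTION OF
# THE RENORMALIZATION STEP (LÉVY–SZEKERES UNIQUENESS).  An ABEL FUNCTION of the flow near zero pin is any `Φ : ℝ → ℝ` with `Φ(h k) = Φ e + kβ₀` along every box solution h
# from every pin `e ∈ ]0, e′]`; there are as many as there are functions on a circle (part 48's witness).  LÉVY's CRITERION: Φ is ASYMPTOTICALLY CHART-ISOMETRIC at the zero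
# pin — for every chart window W and ε > 0 there is δ > 0 with `|(Φ g − Φ g̃) − (1∕g² − 1∕g̃²)| ≤ ε` whenever `0 < g ≤ g̃ ≤ δ` and `1∕g² − 1∕g̃² ≤ W`.  Part 44 showed that every
# DYNAMICAL Abel function (relative Λ, two-loop Λ₂, …) satisfies it quantitatively (§70 `levy_of_dynAbel`).  THE THEOREM (§70 **`abel_levy_rigid`**): ANY TWO Abel functions
# satisfying Lévy's criterion DIFFER BY A CONSTANT on ]0, e′] — run both pins up their trajectories, bracket the running coupling of one between consecutive points of the
# other (chart distance ≤ one increment ≤ `β₀ + C_mγ∕(1−θ)`), and compare across the bracket by the criterion: the invariant difference is read off deeper and deeper where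
# both functions are isometric to the same chart.  COROLLARY (**`abel_levy_eq_dynAbel`**): an Abel function with Lévy's property IS the Λ-coordinate up to an additive
# constant — the Λ-parameter of parts 34–35 is the PRINCIPAL Abel function of the renormalization step in Szekeres' sense, singled out among all conjugacies of the RG to a
# translation by first-order agreement with the perturbative chart `1∕g²`; part 46 builds from it the canonical continuous renormalization group.
# Abstract in B (β-flow team, prover 1, unit `b2b-balaban-beta-bflow-p1`, gen 40; ROW AP-I·Uc × NODE U2 × ROW Λ — uniqueness of the Λ-coordinate)

HONEST FRAMING (page 1 of everything the β sub-cell writes): discharging `BetaPertH` makes Bałaban's UV stability UNCONDITIONAL — a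
real constructive-QFT result; it is NOT the continuum limit and NOT the Clay problem.  HONEST DEPENDENCY (cell reorg 2026-08-19,
verbatim): «continuum YM on T⁴ ⇐ BetaPertH ∧ nine spine estimates (0/9 proved); BetaPertH ⇐ (D1) ∧ (D4) ∧ CAP+tail; G-an2-4 gates
asym, D1 and NE2/3/4.»  THIS MODULE DISCHARGES NOTHING: elementary real analysis (an ε-argument along two trajectories) over node U2's HYPOTHESIS SHAPES
`T4BetaStationary.{SeqBox, MemoryProfile}`, `T4BetaFlowWellPosed.{MemFlow, solution}` on an ABSTRACT functional `B`; part 44's `abs_dynAbel_sub_sub_chart_le ∕ dynAbel_shift ∕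
exists_bracket ∕ invSq_succ_sub_le`, part 34's `package_of_le ∕ succ_le_of_reference_flow`, part 32's `tail_le_invSprof`, part 25's `exists_tail_scale_le`, part 13's
`memFlow_solution_of_reference`, part 10's `invSq_lower_of_reference_flow` BY NAME — nothing restated.  PRECEDENT (classical, cited not imported, PROVED here in the tree's
setting): the uniqueness of the «principal» Abel function under an asymptotic-translation condition — P. Lévy (1928); G. Szekeres, «Regular iteration of real and complex
functions», Acta Math. 100 (1958) 203–258; R. Coifman, J. Aust. Math. Soc. 5 (1965) 36–47; survey M. C. Zdun, ESAIM Proc. 46 (2014) §1.  `ScaleShiftRate` (GAPS G-t4-U2-1),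
`HistLipschitz`∕`FadingMemory` (G-t4-U2-2), [I] THEOREM 2 (p. 259, STATED WITHOUT PROOF) do not occur in this abstract part; NOTHING is asserted about Bałaban's actual β.
[I] = T. Bałaban, Commun. Math. Phys. **109** (1987) 249–301 [Balaban1987RG1].

WHAT THIS FILE PROVES (0 sorry, 0 def): §70 `tendsto_zero_of_profile`, **`levy_of_dynAbel`**, **`abel_levy_rigid`**, **`abel_levy_eq_dynAbel`**.  NOT CLAIMED: uniqueness
WITHOUT Lévy's criterion (false: part 48); anything about Bałaban's β; `BetaPertH`; continuum; Clay.
-/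

namespace Summit.QuantumFields.BalabanUV.Beta.EriceFlowEnclosureB12AsPrintedHistoryContagionShiftFlowZeroPrincipal

open Finset Filter Topology Set
open Literature.MathematicalPhysics.QuantumFieldTheory.Balaban1983to89
open Literature.MathematicalPhysics.QuantumFieldTheory.Balaban1983to89.T4CouplingMatching (sprof sprof_pos)
open Literature.MathematicalPhysics.QuantumFieldTheory.Balaban1983to89.T4BetaStationary (SeqBox MemoryProfile)
open Literature.MathematicalPhysics.QuantumFieldTheory.Balaban1983to89.T4BetaFlowWellPosed (MemFlow solution)
open Summit.QuantumFields.BalabanUV.Beta.EriceFlowEnclosureB12AsPrintedHistoryContagionShiftFlow (invSq_lower_of_reference_flow)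
open Summit.QuantumFields.BalabanUV.Beta.EriceFlowEnclosureB12AsPrintedHistoryContagionShiftFlowPicardLimit (memFlow_solution_of_reference)
open Summit.QuantumFields.BalabanUV.Beta.EriceFlowEnclosureB12AsPrintedHistoryContagionShiftFlowRepinTail (one_div_sprof_pos exists_tail_scale_le)
open Summit.QuantumFields.BalabanUV.Beta.EriceFlowEnclosureB12AsPrintedHistoryContagionShiftFlowZero (tail_le_invSprof)
open Summit.QuantumFields.BalabanUV.Beta.EriceFlowEnclosureB12AsPrintedHistoryContagionShiftFlowZeroOffset (package_of_le succ_le_of_reference_flow)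
open Summit.QuantumFields.BalabanUV.Beta.EriceFlowEnclosureB12AsPrintedHistoryContagionShiftFlowZeroIsometry (dynAbel_shift abs_dynAbel_sub_sub_chart_le
  exists_bracket invSq_succ_sub_le)

noncomputable section

/-! ## §70 Lévy's criterion and the uniqueness of the principal Abel function -/

/-- A positive sequence with an asymptotic-freedom profile `1∕t_a² + β*·m ≤ 1∕h(m)²` (β* > 0) tends to zero. [folklore] -/
theorem tendsto_zero_of_profile {ta bs : ℝ} {h : ℕ → ℝ} (hta : 0 < ta) (hbs : 0 < bs) (hpos : ∀ m, 0 < h m)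
    (hprof : ∀ m : ℕ, 1 / ta ^ 2 + bs * (m : ℝ) ≤ 1 / (h m) ^ 2) : Tendsto h atTop (𝓝 0) := by
  have henv : ∀ m, h m ≤ 1 / sprof ta bs m := fun m => by simpa using tail_le_invSprof hta hbs.le hpos hprof m 0
  have hc : Tendsto (fun m => 1 / sprof ta bs m) atTop (𝓝 0) := by
    refine Metric.tendsto_atTop.mpr fun ε hε => ?_
    obtain ⟨n₀, hn₀⟩ := exists_tail_scale_le hta hbs (half_pos hε)
    refine ⟨n₀, fun n hn => ?_⟩
    rw [Real.dist_eq, sub_zero, abs_of_pos (one_div_sprof_pos hta hbs.le n)]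
    linarith [hn₀ n hn]
  exact squeeze_zero (fun m => (hpos m).le) henv hc

/-- **EVERY DYNAMICAL ABEL FUNCTION SATISFIES LÉVY's CRITERION** (data of part 44's `abs_dynAbel_sub_sub_chart_le`): for every chart window W and every ε > 0 there is
δ > 0 such that `|(Λ g − Λ g̃) − (1∕g² − 1∕g̃²)| ≤ ε` whenever `0 < g ≤ g̃ ≤ δ`, `g̃ ≤ e′` and `1∕g² − 1∕g̃² ≤ W` — with the explicit `δ = min e′ (ε∕(κ(|W|+1)+1))`,
`κ = 64C_m∕(3(1−θ)β*)`. [folklore; criterion: Lévy 1928 ∕ Szekeres 1958] -/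
theorem levy_of_dynAbel {B : (ℕ → ℝ) → ℝ} {Cm θ γ bs ta gs e' : ℝ} {t : ℕ → ℝ} {a : ℕ → ℝ} {Λ : ℝ → ℝ}
    (hB : MemoryProfile Cm θ γ B) (hCm : 0 ≤ Cm) (hθ0 : 0 ≤ θ) (hθ1 : θ < 1) (hbs : 0 < bs) (hta : 0 < ta)
    (hts : SeqBox γ t) (htf : MemFlow B gs t) (hprof : ∀ m : ℕ, 1 / ta ^ 2 + bs * (m : ℝ) ≤ 1 / (t m) ^ 2)
    (hΛ : ∀ e ∈ Ioc (0 : ℝ) e', ∀ h : ℕ → ℝ, SeqBox γ h → MemFlow B e h → Tendsto (fun n => 1 / h n ^ 2 - a n) atTop (𝓝 (Λ e)))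
    (h2e' : 2 * e' ≤ γ)
    (hs1 : 4 * Cm * e' ≤ bs * (1 - θ))
    (hs2 : e' ^ 2 * (1 / gs ^ 2 + Cm * γ / (1 - θ) ^ 2 + (2 * Cm / ((1 - θ) * bs)) ^ 2) ≤ 3 / 4)
    (hs4 : 64 * Cm * e' ^ 3 ≤ (1 - θ) ^ 2) (hs5 : Cm * (8 * e' ^ 3 + 16 * e' / bs) ≤ (1 - θ) / 4) (W : ℝ) {ε : ℝ} (hε : 0 < ε) :
    ∃ δ > 0, ∀ g g' : ℝ, 0 < g → g ≤ g' → g' ≤ δ → g' ≤ e' → 1 / g ^ 2 - 1 / g' ^ 2 ≤ W →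
      |(Λ g - Λ g') - (1 / g ^ 2 - 1 / g' ^ 2)| ≤ ε := by
  have h1θ : 0 < 1 - θ := by linarith
  set κ : ℝ := 64 * Cm / (3 * (1 - θ) * bs) with hκ
  have hκ0 : 0 ≤ κ := by positivity
  refine ⟨ε / (κ * (|W| + 1) + 1), by positivity, fun g g' hg hgg' hg'δ hg'e' hW => ?_⟩
  have hiso := abs_dynAbel_sub_sub_chart_le hB hCm hθ0 hθ1 hbs hta hts htf hprof hΛ h2e' hs1 hs2 hs4 hs5 hg hgg' hg'e'
  have hΔ0 : 0 ≤ 1 / g ^ 2 - 1 / g' ^ 2 := by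
    rw [sub_nonneg]; exact one_div_le_one_div_of_le (by positivity) (pow_le_pow_left₀ hg.le hgg' 2)
  have hΔW : 1 / g ^ 2 - 1 / g' ^ 2 ≤ |W| + 1 := by linarith [le_abs_self W]
  refine hiso.trans ?_
  have hpos : 0 < κ * (|W| + 1) + 1 := by positivity
  calc κ * g' * (1 / g ^ 2 - 1 / g' ^ 2) ≤ κ * (ε / (κ * (|W| + 1) + 1)) * (|W| + 1) := by
        have h1 : κ * g' ≤ κ * (ε / (κ * (|W| + 1) + 1)) := mul_le_mul_of_nonneg_left hg'δ hκ0
        exact mul_le_mul h1 hΔW hΔ0 (by positivity)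
    _ = ε * (κ * (|W| + 1) / (κ * (|W| + 1) + 1)) := by field_simp
    _ ≤ ε * 1 := by
        refine mul_le_mul_of_nonneg_left ?_ hε.le
        rw [div_le_one hpos]; linarith
    _ = ε := mul_one ε

/-- **LÉVY–SZEKERES UNIQUENESS: TWO ABEL FUNCTIONS OF THE TRAJECTORIES THAT SATISFY LÉVY's CRITERION DIFFER BY A CONSTANT.**  `B` with memory profile `(C_m, θ)` on ]0, γ]^ℕ and
the value β₀ at the zero history; ONE AF reference t; the reference pin e′ with part 14's package.  `Φ₁, Φ₂ : ℝ → ℝ` two ABEL FUNCTIONS of the flow on ]0, e′] —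
`Φᵢ(h k) = Φᵢ e + kβ₀` along every box solution from every pin of ]0, e′] — both satisfying LÉVY's CRITERION (the shape of `levy_of_dynAbel`'s conclusion).  THEN
**`Φ₁ g − Φ₂ g = Φ₁ e′ − Φ₂ e′` for every `g ∈ ]0, e′]`**: the difference is invariant along trajectories; running the pins g and e′ up THEIR trajectories, the running
coupling from g is bracketed by consecutive points of the reference trajectory at chart distance ≤ one increment `≤ β₀ + C_mγ∕(1 − θ)`, arbitrarily deep, where both Φᵢ are
ε-isometric to the same chart — so the two invariant differences agree to 2ε for every ε.  [folklore; classical statement: Lévy 1928, Szekeres 1958 («principal Abel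
function»), proved here for the flow with memory] -/
theorem abel_levy_rigid {B : (ℕ → ℝ) → ℝ} {Cm θ γ β₀ bs ta gs e' : ℝ} {t h' : ℕ → ℝ} {Φ₁ Φ₂ : ℝ → ℝ}
    (hB : MemoryProfile Cm θ γ B) (hCm : 0 ≤ Cm) (hθ0 : 0 ≤ θ) (hθ1 : θ < 1) (hbs : 0 < bs) (hta : 0 < ta)
    (h0 : ∀ u : ℕ → ℝ, SeqBox γ u → |B u - β₀| ≤ Cm * ∑' j, θ ^ j * u j)
    (hts : SeqBox γ t) (htf : MemFlow B gs t) (hprof : ∀ m : ℕ, 1 / ta ^ 2 + bs * (m : ℝ) ≤ 1 / (t m) ^ 2)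
    (he' : 0 < e') (h2e' : 2 * e' ≤ γ)
    (hs1 : 4 * Cm * e' ≤ bs * (1 - θ))
    (hs2 : e' ^ 2 * (1 / gs ^ 2 + Cm * γ / (1 - θ) ^ 2 + (2 * Cm / ((1 - θ) * bs)) ^ 2) ≤ 3 / 4)
    (hs4 : 64 * Cm * e' ^ 3 ≤ (1 - θ) ^ 2) (hs5 : Cm * (8 * e' ^ 3 + 16 * e' / bs) ≤ (1 - θ) / 4)
    (hhs' : SeqBox γ h') (hhf' : MemFlow B e' h')
    (hΦ₁ : ∀ e ∈ Ioc (0 : ℝ) e', ∀ h : ℕ → ℝ, SeqBox γ h → MemFlow B e h → ∀ k : ℕ, Φ₁ (h k) = Φ₁ e + (k : ℝ) * β₀)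
    (hL₁ : ∀ W ε : ℝ, 0 < ε → ∃ δ > 0, ∀ g g' : ℝ, 0 < g → g ≤ g' → g' ≤ δ → g' ≤ e' → 1 / g ^ 2 - 1 / g' ^ 2 ≤ W →
      |(Φ₁ g - Φ₁ g') - (1 / g ^ 2 - 1 / g' ^ 2)| ≤ ε)
    (hΦ₂ : ∀ e ∈ Ioc (0 : ℝ) e', ∀ h : ℕ → ℝ, SeqBox γ h → MemFlow B e h → ∀ k : ℕ, Φ₂ (h k) = Φ₂ e + (k : ℝ) * β₀)
    (hL₂ : ∀ W ε : ℝ, 0 < ε → ∃ δ > 0, ∀ g g' : ℝ, 0 < g → g ≤ g' → g' ≤ δ → g' ≤ e' → 1 / g ^ 2 - 1 / g' ^ 2 ≤ W →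
      |(Φ₂ g - Φ₂ g') - (1 / g ^ 2 - 1 / g' ^ 2)| ≤ ε)
    {g : ℝ} (hg : 0 < g) (hge' : g ≤ e') : Φ₁ g - Φ₂ g = Φ₁ e' - Φ₂ e' := by
  have h1θ : 0 < 1 - θ := by linarith
  have hγ : 0 ≤ γ := by linarith
  have he'mem : e' ∈ Ioc (0 : ℝ) e' := ⟨he', le_rfl⟩
  have hgmem : g ∈ Ioc (0 : ℝ) e' := ⟨hg, hge'⟩
  -- THE solution from g, with its AF profile
  obtain ⟨p1, p2, p4, -⟩ := package_of_le hCm hθ1 hbs hγ hg hge' hs1 hs2 hs4 hs5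
  obtain ⟨hgs, hgf, hgprof, -⟩ := memFlow_solution_of_reference hB hCm hθ0 hθ1 hbs hta hts htf hprof hg (by linarith) p1 p2 p4
  -- the reference trajectory decreases to zero from e′
  have hprof' : ∀ m : ℕ, 1 / (2 * e') ^ 2 + bs / 4 * (m : ℝ) ≤ 1 / (h' m) ^ 2 := fun m => by
    have := invSq_lower_of_reference_flow hB hCm hθ0 hθ1 hbs hta hts htf hprof hhs' hhf' hs1 hs2 m
    rwa [show (1 : ℝ) / (2 * e') ^ 2 = 1 / (4 * e' ^ 2) by ring]
  have hlim0 : Tendsto h' atTop (𝓝 0) :=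
    tendsto_zero_of_profile (by positivity : (0 : ℝ) < 2 * e') (by positivity : (0 : ℝ) < bs / 4) (fun m => (hhs' m).1) hprof'
  -- the invariant difference, read at depth n of the g-trajectory against the bracketing reference point
  set W : ℝ := β₀ + Cm * γ / (1 - θ) with hW
  have key : ∀ ε : ℝ, 0 < ε → |(Φ₁ g - Φ₂ g) - (Φ₁ e' - Φ₂ e')| ≤ 2 * ε := by
    intro ε hε
    obtain ⟨δ₁, hδ₁, hL₁'⟩ := hL₁ W ε hε
    obtain ⟨δ₂, hδ₂, hL₂'⟩ := hL₂ W ε hε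
    set δ : ℝ := min δ₁ δ₂ with hδ
    have hδ0 : 0 < δ := lt_min hδ₁ hδ₂
    -- a depth n at which the g-trajectory is below δ by more than one chart increment
    obtain ⟨n, hn⟩ := exists_nat_ge ((1 / δ ^ 2 + W) / (bs / 4))
    have hn' : 1 / δ ^ 2 + W ≤ 1 / (solution B g n) ^ 2 := by
      have h1 : (1 / δ ^ 2 + W) / (bs / 4) * (bs / 4) ≤ (n : ℝ) * (bs / 4) := mul_le_mul_of_nonneg_right hn (by positivity)
      rw [div_mul_cancel₀ _ (by positivity : bs / 4 ≠ 0)] at h1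
      have h2 := hgprof n
      have h3 : 0 ≤ 1 / (4 * g ^ 2) := by positivity
      linarith
    set x : ℝ := solution B g n with hx
    have hx0 : 0 < x := (hgs n).1
    have hxe' : x ≤ e' := (succ_le_of_reference_flow hB hCm hθ0 hθ1 hbs hta h0 hts htf hprof hgs hgf p1 p2 n).2.2.trans hge'
    -- bracket x by the reference trajectory
    obtain ⟨m, hm1, hm2⟩ := exists_bracket hhf'.1 hlim0 hx0 hxe'
    have hm0 : 0 < h' m := (hhs' m).1
    have hm0' : 0 < h' (m + 1) := (hhs' (m + 1)).1
    have hme' : h' m ≤ e' := (succ_le_of_reference_flow hB hCm hθ0 hθ1 hbs hta h0 hts htf hprof hhs' hhf' hs1 hs2 m).2.2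
    have hinc := invSq_succ_sub_le hCm hθ0 hθ1 h0 hhs' hhf' m
    have hΔW : 1 / x ^ 2 - 1 / h' m ^ 2 ≤ W := by
      have : 1 / x ^ 2 ≤ 1 / h' (m + 1) ^ 2 := one_div_le_one_div_of_le (by positivity) (pow_le_pow_left₀ hm0'.le hm1.le 2)
      linarith
    -- the bracketing point is itself below δ
    have hmδ : h' m ≤ δ := by
      have h1 : 1 / δ ^ 2 ≤ 1 / h' m ^ 2 := by linarith [hn', hΔW]
      have h2 : h' m ^ 2 ≤ δ ^ 2 := (one_div_le_one_div (pow_pos hδ0 2) (pow_pos hm0 2)).mp h1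
      exact (pow_le_pow_iff_left₀ hm0.le hδ0.le two_ne_zero).mp h2
    -- both Abel functions: invariance along the two trajectories
    have e₁ : Φ₁ g - Φ₁ e' = Φ₁ x - Φ₁ (h' m) - ((n : ℝ) - m) * β₀ := by
      rw [hx, hΦ₁ g hgmem _ hgs hgf n, hΦ₁ e' he'mem h' hhs' hhf' m]; ring
    have e₂ : Φ₂ g - Φ₂ e' = Φ₂ x - Φ₂ (h' m) - ((n : ℝ) - m) * β₀ := by
      rw [hx, hΦ₂ g hgmem _ hgs hgf n, hΦ₂ e' he'mem h' hhs' hhf' m]; ring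
    have b₁ := hL₁' x (h' m) hx0 hm2 (hmδ.trans (min_le_left _ _)) hme' hΔW
    have b₂ := hL₂' x (h' m) hx0 hm2 (hmδ.trans (min_le_right _ _)) hme' hΔW
    calc |(Φ₁ g - Φ₂ g) - (Φ₁ e' - Φ₂ e')| = |((Φ₁ x - Φ₁ (h' m)) - (1 / x ^ 2 - 1 / h' m ^ 2)) - ((Φ₂ x - Φ₂ (h' m)) - (1 / x ^ 2 - 1 / h' m ^ 2))| := by
          rw [show (Φ₁ g - Φ₂ g) - (Φ₁ e' - Φ₂ e') = (Φ₁ g - Φ₁ e') - (Φ₂ g - Φ₂ e') by ring, e₁, e₂]; ring_nf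
      _ ≤ |(Φ₁ x - Φ₁ (h' m)) - (1 / x ^ 2 - 1 / h' m ^ 2)| + |(Φ₂ x - Φ₂ (h' m)) - (1 / x ^ 2 - 1 / h' m ^ 2)| := abs_sub _ _
      _ ≤ ε + ε := add_le_add b₁ b₂
      _ = 2 * ε := by ring
  -- hence the two invariant differences coincide
  have hzero : |(Φ₁ g - Φ₂ g) - (Φ₁ e' - Φ₂ e')| ≤ 0 := by
    refine le_of_forall_pos_le_add fun ε hε => ?_
    have := key (ε / 2) (half_pos hε)
    linarith
  have := abs_nonpos_iff.mp hzero
  linarith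

/-- **THE Λ-COORDINATE IS THE PRINCIPAL ABEL FUNCTION.**  Under the data of `abel_levy_rigid` with Λ a DYNAMICAL Abel function (any comparison sequence, parts 35 ∕ 40 ∕ 44)
and Φ ANY Abel function of the trajectories on ]0, e′] satisfying Lévy's criterion: **`Φ g = Λ g + (Φ e′ − Λ e′)` on ]0, e′]** — among all conjugacies of the
renormalization step to the translation by β₀, the Λ-parameter is singled out (up to its additive constant) by first-order agreement with the chart `1∕g²` at the zero pin.
[folklore; Szekeres 1958 «principal Abel function», proved here] -/
theorem abel_levy_eq_dynAbel {B : (ℕ → ℝ) → ℝ} {Cm θ γ β₀ bs ta gs e' : ℝ} {t h' : ℕ → ℝ} {a : ℕ → ℝ} {Λ Φ : ℝ → ℝ}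
    (hB : MemoryProfile Cm θ γ B) (hCm : 0 ≤ Cm) (hθ0 : 0 ≤ θ) (hθ1 : θ < 1) (hbs : 0 < bs) (hta : 0 < ta)
    (h0 : ∀ u : ℕ → ℝ, SeqBox γ u → |B u - β₀| ≤ Cm * ∑' j, θ ^ j * u j)
    (hts : SeqBox γ t) (htf : MemFlow B gs t) (hprof : ∀ m : ℕ, 1 / ta ^ 2 + bs * (m : ℝ) ≤ 1 / (t m) ^ 2)
    (hΛ : ∀ e ∈ Ioc (0 : ℝ) e', ∀ h : ℕ → ℝ, SeqBox γ h → MemFlow B e h → Tendsto (fun n => 1 / h n ^ 2 - a n) atTop (𝓝 (Λ e)))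
    (he' : 0 < e') (h2e' : 2 * e' ≤ γ)
    (hs1 : 4 * Cm * e' ≤ bs * (1 - θ))
    (hs2 : e' ^ 2 * (1 / gs ^ 2 + Cm * γ / (1 - θ) ^ 2 + (2 * Cm / ((1 - θ) * bs)) ^ 2) ≤ 3 / 4)
    (hs4 : 64 * Cm * e' ^ 3 ≤ (1 - θ) ^ 2) (hs5 : Cm * (8 * e' ^ 3 + 16 * e' / bs) ≤ (1 - θ) / 4)
    (hhs' : SeqBox γ h') (hhf' : MemFlow B e' h')
    (hΦ : ∀ e ∈ Ioc (0 : ℝ) e', ∀ h : ℕ → ℝ, SeqBox γ h → MemFlow B e h → ∀ k : ℕ, Φ (h k) = Φ e + (k : ℝ) * β₀)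
    (hL : ∀ W ε : ℝ, 0 < ε → ∃ δ > 0, ∀ g g' : ℝ, 0 < g → g ≤ g' → g' ≤ δ → g' ≤ e' → 1 / g ^ 2 - 1 / g' ^ 2 ≤ W →
      |(Φ g - Φ g') - (1 / g ^ 2 - 1 / g' ^ 2)| ≤ ε)
    {g : ℝ} (hg : 0 < g) (hge' : g ≤ e') : Φ g = Λ g + (Φ e' - Λ e') := by
  have hγ : 0 ≤ γ := by linarith
  have hΛabel : ∀ e ∈ Ioc (0 : ℝ) e', ∀ h : ℕ → ℝ, SeqBox γ h → MemFlow B e h → ∀ k : ℕ, Λ (h k) = Λ e + (k : ℝ) * β₀ := by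
    intro e he h hhs hhf k
    obtain ⟨p1, p2, -, -⟩ := package_of_le hCm hθ1 hbs hγ he.1 he.2 hs1 hs2 hs4 hs5
    exact dynAbel_shift hB hCm hθ0 hθ1 hbs hta h0 hts htf hprof hΛ he hhs hhf p1 p2 k
  have hΛL : ∀ W ε : ℝ, 0 < ε → ∃ δ > 0, ∀ g g' : ℝ, 0 < g → g ≤ g' → g' ≤ δ → g' ≤ e' → 1 / g ^ 2 - 1 / g' ^ 2 ≤ W →
      |(Λ g - Λ g') - (1 / g ^ 2 - 1 / g' ^ 2)| ≤ ε := fun W ε hε =>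
    levy_of_dynAbel hB hCm hθ0 hθ1 hbs hta hts htf hprof hΛ h2e' hs1 hs2 hs4 hs5 W hε
  have h := abel_levy_rigid hB hCm hθ0 hθ1 hbs hta h0 hts htf hprof he' h2e' hs1 hs2 hs4 hs5 hhs' hhf' hΦ hL hΛabel hΛL hg hge'
  linarith

end

end Summit.QuantumFields.BalabanUV.Beta.EriceFlowEnclosureB12AsPrintedHistoryContagionShiftFlowZeroPrincipal
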